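import Mathlib
import HarnessLib
import Literature.Probability.MarkovChains.MarkovChainDecomposition

/-!
HONEST FRAMING: exact (Metropolis-corrected) sampling algorithms for lattice gauge theory; figures
of merit are autocorrelation/cost numbers at stated couplings and volumes; no continuum-physics
claim.

# TemperingLikelihoodRatio — PERSISTENCE AND MODE-RESTRICTED OVERLAPS FROM ADJACENT LIKELIHOOD RATIOS: IF
# `μ_{l+1} ≤ e^{r}μ_l` AND `μ_l ≤ e^{r}μ_{l+1}` POINTWISE THEN EVERY SET HAS RESTRICTED OVERLAP CONSTANT `δ = e^{−r}` AND
# PERSISTENCE `p = e^{−Kr}`; FOR TEMPERING IN THE COUPLING OF `w·e^{βX}` WITH `|X(x) − X(y)| ≤ R` AND STEPS `≤ Δ`: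
# `r = ΔR`, SO `p ≥ e^{−WR}` ON A WINDOW `KΔ ≤ W` AND `δ ≥ e^{−1}` ONCE `ΔR ≤ 1` (lean-2 GEN-17, ours)

Venture-side (OURS).  Cell `lqcd-flow` (pub-lqcd), unit `pub-lqcd-lean-2-g17`, 2026-08-25.  Docking lemmas for
chapter Y: `Scaling/SimulatedTemperingModeGap` bounds the simulated-tempering sampler's spectral gap from below through
two ladder quantities of a mode partition `mode : S → J` (block `A_j = {mode = j}`, masses
`μ_k(A_j) = blockMass (μ k) mode j`): PERSISTENCE `p` (`p·μ_l(A_j) ≤ μ_k(A_j)` for `k ≤ l`, level `0` the hot end) and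
MODE-RESTRICTED OVERLAPS `δ` (`δ·min{μ_l(A_j), μ_{l+1}(A_j)} ≤ Σ_{x ∈ A_j} min{μ_l(x), μ_{l+1}(x)}`).  This file derives
both, for EVERY set at once, from a pointwise bound on adjacent likelihood ratios, and computes that bound for
tempering in the coupling of an exponential family on a finite configuration space (the family is given by
HYPOTHESES `μ_k(x) = w(x)e^{β_k X(x)}/Σ_y w(y)e^{β_k X(y)}` — no new definitions).

## What is proved

* §1 (`r ≥ 0`; `μ_{l+1}(x) ≤ e^{r}μ_l(x)` and `μ_l(x) ≤ e^{r}μ_{l+1}(x)` for all adjacent levels, all `x`):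
  **`ladderRatio_restrictedOverlap`** — `e^{−r}·min{μ_l(A), μ_{l+1}(A)} ≤ Σ_{x ∈ A} min{μ_l(x), μ_{l+1}(x)}` for
  every `A`; `ladderRatio_pow` — `μ_{k+n}(x) ≤ e^{nr}μ_k(x)`; **`ladderRatio_persistence`** — `e^{−Kr}·μ_l(A) ≤ μ_k(A)`
  for `k ≤ l`, every `A`; in the vocabulary of chapter Y: `ladderRatio_hδ`, `ladderRatio_hpers`.
* §2 **`expFamily_ratio_le`** — for `w > 0`, `|X(x) − X(y)| ≤ R`, `|β′ − β| ≤ Δ`: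
  `w(x)e^{β′X(x)}/Z(β′) ≤ e^{ΔR}·w(x)e^{βX(x)}/Z(β)`; **`expFamily_adjacent_ratio`** — the tempering ladder of the
  family with steps `|β_{l+1} − β_l| ≤ Δ` satisfies §1 with `r = ΔR`.
* §3 **`expFamily_hδ`** (`δ = e^{−ΔR}`), **`expFamily_hpers`** (`p = e^{−KΔR}`), `expFamily_hpers_window`
  (`p = e^{−WR}` whenever `KΔ ≤ W`), `expFamily_hδ_unit` (`δ = e^{−1}` whenever `ΔR ≤ 1`) — exactly the hypotheses
  `hpers`, `hδ` of `Scaling/SimulatedTemperingModeGap`, for every mode partition.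

Reading (no numerics implied): with no structural input the persistence of a mode under tempering in the coupling is
guaranteed only down to `e^{−(window)·(oscillation of the action)}` — for an extensive action, exponentially small in
VOLUME × WINDOW — while mode-restricted overlaps are `≥ e^{−1}` once the spacing is `≤ 1/osc(X)` (a volume-linear
number of levels; the `√volume` variance law of `Scaling/SimulatedTemperingFiniteWindowLaw` is the sharper statement
for unrestricted overlaps).  Topological sectors of lattice gauge theory are expected to persist far better than this
generic floor — model input, NOT CLAIMED here; also NOT CLAIMED: general configuration spaces, anything measured.
Literature grade (cell rule): ELEMENTARY (likelihood-ratio bookkeeping), NEW TYPING (the hypotheses of chapter Y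
discharged for the exponential family); nothing cited as a fact; no new bib keys.
-/

noncomputable section

open Finset Real
open Literature.Probability.MarkovChains.Decomposition

namespace Summit.Ventures.LatticeQCDFlow.Scaling

variable {S : Type*} [Fintype S] {K : ℕ} {μ : Fin (K + 1) → S → ℝ}

/-! ## §1 Adjacent likelihood ratios ⇒ restricted overlaps and persistence -/

section Ratio

variable {r : ℝ} (hr0 : 0 ≤ r) (hμ0 : ∀ k x, 0 ≤ μ k x)
  (hr : ∀ (l : Fin K) (x : S), μ l.succ x ≤ exp r * μ l.castSucc x ∧ μ l.castSucc x ≤ exp r * μ l.succ x)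
include hr0 hμ0 hr

omit [Fintype S] in
/-- **Restricted overlaps from adjacent likelihood ratios:** `e^{−r}·min{μ_l(A), μ_{l+1}(A)} ≤ Σ_{x ∈ A}
min{μ_l(x), μ_{l+1}(x)}` for every set `A`. [ours] -/
theorem ladderRatio_restrictedOverlap (l : Fin K) (A : Finset S) :
    exp (-r) * min (∑ x ∈ A, μ l.castSucc x) (∑ x ∈ A, μ l.succ x)
      ≤ ∑ x ∈ A, min (μ l.castSucc x) (μ l.succ x) := by
  have he : exp (-r) * exp r = 1 := by rw [← exp_add]; simp
  have he1 : exp (-r) ≤ 1 := by rw [exp_le_one_iff]; linarith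
  have hpt : ∀ x, exp (-r) * μ l.castSucc x ≤ min (μ l.castSucc x) (μ l.succ x) := by
    intro x
    refine le_min ?_ ?_
    · calc exp (-r) * μ l.castSucc x ≤ 1 * μ l.castSucc x := mul_le_mul_of_nonneg_right he1 (hμ0 _ _)
        _ = μ l.castSucc x := one_mul _
    · calc exp (-r) * μ l.castSucc x ≤ exp (-r) * (exp r * μ l.succ x) :=
          mul_le_mul_of_nonneg_left (hr l x).2 (exp_pos _).le
        _ = μ l.succ x := by rw [← mul_assoc, he, one_mul]
  calc exp (-r) * min (∑ x ∈ A, μ l.castSucc x) (∑ x ∈ A, μ l.succ x)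
      ≤ exp (-r) * ∑ x ∈ A, μ l.castSucc x := mul_le_mul_of_nonneg_left (min_le_left _ _) (exp_pos _).le
    _ = ∑ x ∈ A, exp (-r) * μ l.castSucc x := Finset.mul_sum _ _ _
    _ ≤ ∑ x ∈ A, min (μ l.castSucc x) (μ l.succ x) := sum_le_sum fun x _ => hpt x

omit [Fintype S] hr0 hμ0 in
/-- `μ_{k+n}(x) ≤ e^{nr}·μ_k(x)`: the ratio bound iterated down the ladder. [ours] -/
theorem ladderRatio_pow (x : S) (n : ℕ) :
    ∀ (k : Fin (K + 1)) (h : k.val + n < K + 1), μ ⟨k.val + n, h⟩ x ≤ exp (n * r) * μ k x := by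
  induction n with
  | zero =>
    intro k h
    simp
  | succ n ih =>
    intro k h
    set i : Fin K := ⟨k.val + n, by omega⟩ with hi
    have e1 : (⟨k.val + (n + 1), h⟩ : Fin (K + 1)) = i.succ := Fin.ext (by simp [hi]; omega)
    have e2 : (⟨k.val + n, by omega⟩ : Fin (K + 1)) = i.castSucc := Fin.ext (by simp [hi])
    have h1 := (hr i x).1
    have h2 := ih k (by omega)
    rw [e2] at h2
    rw [e1]
    calc μ i.succ x ≤ exp r * μ i.castSucc x := h1
      _ ≤ exp r * (exp (n * r) * μ k x) := mul_le_mul_of_nonneg_left h2 (exp_pos _).le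
      _ = exp (((n + 1 : ℕ) : ℝ) * r) * μ k x := by
          rw [← mul_assoc, ← exp_add]
          push_cast
          ring_nf

omit [Fintype S] in
/-- **Persistence from adjacent likelihood ratios:** `e^{−Kr}·μ_l(A) ≤ μ_k(A)` for `k ≤ l` and every set `A`.
[ours] -/
theorem ladderRatio_persistence {k l : Fin (K + 1)} (hkl : k ≤ l) (A : Finset S) :
    exp (-(K * r)) * ∑ x ∈ A, μ l x ≤ ∑ x ∈ A, μ k x := by
  obtain ⟨n, hn⟩ : ∃ n : ℕ, l.val = k.val + n := ⟨l.val - k.val, by rw [Fin.le_def] at hkl; omega⟩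
  have hlt : k.val + n < K + 1 := by have := l.2; omega
  have hl : l = ⟨k.val + n, hlt⟩ := Fin.ext hn
  have hnK : (n : ℝ) * r ≤ K * r := by
    have : (n : ℝ) ≤ K := by exact_mod_cast (show n ≤ K by omega)
    exact mul_le_mul_of_nonneg_right this hr0
  rw [Finset.mul_sum]
  refine sum_le_sum fun x _ => ?_
  have hx := ladderRatio_pow hr x n k hlt
  rw [← hl] at hx
  -- `μ_l ≤ e^{nr}μ_k ≤ e^{Kr}μ_k`, i.e. `e^{−Kr}μ_l ≤ μ_k`
  have h2 : μ l x ≤ exp (K * r) * μ k x :=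
    hx.trans (mul_le_mul_of_nonneg_right (exp_le_exp.mpr hnK) (hμ0 _ _))
  have he : exp (-(K * r)) * exp (K * r) = 1 := by rw [← exp_add]; simp
  calc exp (-(K * r)) * μ l x ≤ exp (-(K * r)) * (exp (K * r) * μ k x) :=
        mul_le_mul_of_nonneg_left h2 (exp_pos _).le
    _ = μ k x := by rw [← mul_assoc, he, one_mul]

variable {J : Type*} [DecidableEq J] (mode : S → J)

/-- The restricted-overlap hypothesis `hδ` of `Scaling/SimulatedTemperingModeGap` with `δ = e^{−r}`, for every
mode partition. [ours] -/
theorem ladderRatio_hδ (l : Fin K) (j : J) :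
    exp (-r) * min (blockMass (μ l.castSucc) mode j) (blockMass (μ l.succ) mode j)
      ≤ ∑ x ∈ block mode j, min (μ l.castSucc x) (μ l.succ x) :=
  ladderRatio_restrictedOverlap hr0 hμ0 hr l (block mode j)

/-- The persistence hypothesis `hpers` of `Scaling/SimulatedTemperingModeGap` with `p = e^{−Kr}`, for every mode
partition. [ours] -/
theorem ladderRatio_hpers (k l : Fin (K + 1)) (j : J) (hkl : k ≤ l) :
    exp (-(K * r)) * blockMass (μ l) mode j ≤ blockMass (μ k) mode j :=
  ladderRatio_persistence hr0 hμ0 hr hkl (block mode j)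

end Ratio

/-! ## §2 The exponential family: adjacent likelihood ratios `≤ e^{ΔR}` -/

section ExpFamily

variable {w X : S → ℝ} {R : ℝ} (hw : ∀ x, 0 < w x) (hX : ∀ x y, |X x - X y| ≤ R)
include hw hX

/-- **Two members of the family `w·e^{βX}/Z(β)` differ pointwise by at most `e^{|β′−β|·R} ≤ e^{ΔR}`:**
`w(x)e^{β′X(x)}/Z(β′) ≤ e^{ΔR}·w(x)e^{βX(x)}/Z(β)` when `|β′ − β| ≤ Δ` and `|X(x) − X(y)| ≤ R`. [ours] -/
theorem expFamily_ratio_le {β β' Δ : ℝ} (hd : |β' - β| ≤ Δ) (x : S) :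
    w x * exp (β' * X x) / ∑ y, w y * exp (β' * X y)
      ≤ exp (Δ * R) * (w x * exp (β * X x) / ∑ y, w y * exp (β * X y)) := by
  have hR : 0 ≤ R := le_trans (abs_nonneg _) (hX x x)
  have hZ : 0 < ∑ y, w y * exp (β * X y) :=
    Finset.sum_pos (fun y _ => mul_pos (hw y) (exp_pos _)) ⟨x, mem_univ x⟩
  have hZ' : 0 < ∑ y, w y * exp (β' * X y) :=
    Finset.sum_pos (fun y _ => mul_pos (hw y) (exp_pos _)) ⟨x, mem_univ x⟩
  -- `Z(β') ≥ e^{(β'−β)X(x) − ΔR}·Z(β)` termwise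
  have hlow : exp ((β' - β) * X x - Δ * R) * ∑ y, w y * exp (β * X y) ≤ ∑ y, w y * exp (β' * X y) := by
    rw [Finset.mul_sum]
    refine sum_le_sum fun y _ => ?_
    have hxy : (β' - β) * X x - Δ * R ≤ (β' - β) * (X y) := by
      -- `(β'−β)(X x − X y) ≤ |β'−β|·|X x − X y| ≤ ΔR`
      have h1 : (β' - β) * (X x - X y) ≤ |β' - β| * |X x - X y| := by
        rw [← abs_mul]; exact le_abs_self _
      have h2 : |β' - β| * |X x - X y| ≤ Δ * R :=
        mul_le_mul hd (hX x y) (abs_nonneg _) (le_trans (abs_nonneg _) hd)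
      nlinarith
    calc exp ((β' - β) * X x - Δ * R) * (w y * exp (β * X y))
        = w y * (exp ((β' - β) * X x - Δ * R) * exp (β * X y)) := by ring
      _ ≤ w y * (exp ((β' - β) * X y) * exp (β * X y)) :=
          mul_le_mul_of_nonneg_left (mul_le_mul_of_nonneg_right (exp_le_exp.mpr hxy) (exp_pos _).le) (hw y).le
      _ = w y * exp (β' * X y) := by rw [← exp_add]; ring_nf
  have key : exp (β' * X x) * ∑ y, w y * exp (β * X y)
      ≤ exp (β * X x) * (exp (Δ * R) * ∑ y, w y * exp (β' * X y)) := by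
    have e : exp (β' * X x) * ∑ y, w y * exp (β * X y)
        = exp (β * X x) * (exp (Δ * R) * (exp ((β' - β) * X x - Δ * R) * ∑ y, w y * exp (β * X y))) := by
      rw [← mul_assoc, ← mul_assoc, ← exp_add, ← exp_add]
      ring_nf
    rw [e]
    exact mul_le_mul_of_nonneg_left (mul_le_mul_of_nonneg_left hlow (exp_pos _).le) (exp_pos _).le
  rw [← mul_div_assoc, div_le_div_iff₀ hZ' hZ]
  calc w x * exp (β' * X x) * ∑ y, w y * exp (β * X y)
      = w x * (exp (β' * X x) * ∑ y, w y * exp (β * X y)) := by ring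
    _ ≤ w x * (exp (β * X x) * (exp (Δ * R) * ∑ y, w y * exp (β' * X y))) :=
        mul_le_mul_of_nonneg_left key (hw x).le
    _ = exp (Δ * R) * (w x * exp (β * X x)) * ∑ y, w y * exp (β' * X y) := by ring

variable {β : Fin (K + 1) → ℝ} {Δ : ℝ}
  (hμZ : ∀ k x, μ k x = w x * exp (β k * X x) / ∑ y, w y * exp (β k * X y))
  (hβ : ∀ l : Fin K, |β l.succ - β l.castSucc| ≤ Δ)
include hμZ hβ

/-- **The tempering ladder of the family has adjacent likelihood ratios `≤ e^{ΔR}`** (both directions). [ours] -/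
theorem expFamily_adjacent_ratio (l : Fin K) (x : S) :
    μ l.succ x ≤ exp (Δ * R) * μ l.castSucc x ∧ μ l.castSucc x ≤ exp (Δ * R) * μ l.succ x := by
  refine ⟨?_, ?_⟩
  · rw [hμZ, hμZ]
    exact expFamily_ratio_le hw hX (hβ l) x
  · rw [hμZ, hμZ]
    refine expFamily_ratio_le hw hX ?_ x
    rw [abs_sub_comm]; exact hβ l

omit hX hβ in
/-- The family is positive. [ours] -/
theorem expFamily_pos (k : Fin (K + 1)) (x : S) : 0 < μ k x := by
  rw [hμZ]
  exact div_pos (mul_pos (hw x) (exp_pos _)) (Finset.sum_pos (fun y _ => mul_pos (hw y) (exp_pos _)) ⟨x, mem_univ x⟩)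

/-! ## §3 The hypotheses of chapter Y for the exponential family -/

variable {J : Type*} [DecidableEq J] (mode : S → J)

omit [Fintype S] hw hμZ in
/-- `ΔR ≥ 0`. [ours] -/
theorem expFamily_step_nonneg [Nonempty S] (hK : 0 < K) : 0 ≤ Δ * R := by
  obtain ⟨x⟩ := ‹Nonempty S›
  have hR : 0 ≤ R := le_trans (abs_nonneg _) (hX x x)
  have hΔ : 0 ≤ Δ := le_trans (abs_nonneg _) (hβ ⟨0, hK⟩)
  exact mul_nonneg hΔ hR

/-- **`hδ` with `δ = e^{−ΔR}`** for every mode partition. [ours] -/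
theorem expFamily_hδ [Nonempty S] (hK : 0 < K) (l : Fin K) (j : J) :
    exp (-(Δ * R)) * min (blockMass (μ l.castSucc) mode j) (blockMass (μ l.succ) mode j)
      ≤ ∑ x ∈ block mode j, min (μ l.castSucc x) (μ l.succ x) :=
  ladderRatio_hδ (expFamily_step_nonneg hX hβ hK) (fun k x => (expFamily_pos hw hμZ k x).le)
    (expFamily_adjacent_ratio hw hX hμZ hβ) mode l j

/-- **`hpers` with `p = e^{−KΔR}`** for every mode partition. [ours] -/
theorem expFamily_hpers [Nonempty S] (hK : 0 < K) (k l : Fin (K + 1)) (j : J) (hkl : k ≤ l) :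
    exp (-(K * (Δ * R))) * blockMass (μ l) mode j ≤ blockMass (μ k) mode j :=
  ladderRatio_hpers (expFamily_step_nonneg hX hβ hK) (fun k x => (expFamily_pos hw hμZ k x).le)
    (expFamily_adjacent_ratio hw hX hμZ hβ) mode k l j hkl

/-- **Persistence on a window:** if the ladder spans at most `W` (`KΔ ≤ W`) then `p = e^{−WR}` works. [ours] -/
theorem expFamily_hpers_window [Nonempty S] (hK : 0 < K) {W : ℝ} (hW : K * Δ ≤ W) (k l : Fin (K + 1)) (j : J)
    (hkl : k ≤ l) :
    exp (-(W * R)) * blockMass (μ l) mode j ≤ blockMass (μ k) mode j := by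
  obtain ⟨x⟩ := ‹Nonempty S›
  have hR : 0 ≤ R := le_trans (abs_nonneg _) (hX x x)
  have hmono : exp (-(W * R)) ≤ exp (-(K * (Δ * R))) := by
    rw [exp_le_exp]
    nlinarith [mul_le_mul_of_nonneg_right hW hR]
  have hB : 0 ≤ blockMass (μ l) mode j :=
    blockMass_nonneg (fun x => (expFamily_pos hw hμZ l x).le) mode j
  exact (mul_le_mul_of_nonneg_right hmono hB).trans (expFamily_hpers hw hX hμZ hβ mode hK k l j hkl)

/-- **Restricted overlaps `≥ e^{−1}`** once the spacing resolves the action's oscillation (`ΔR ≤ 1`). [ours] -/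
theorem expFamily_hδ_unit [Nonempty S] (hK : 0 < K) (h1 : Δ * R ≤ 1) (l : Fin K) (j : J) :
    exp (-1) * min (blockMass (μ l.castSucc) mode j) (blockMass (μ l.succ) mode j)
      ≤ ∑ x ∈ block mode j, min (μ l.castSucc x) (μ l.succ x) := by
  have hmono : exp (-1) ≤ exp (-(Δ * R)) := exp_le_exp.mpr (by linarith)
  have hB : 0 ≤ min (blockMass (μ l.castSucc) mode j) (blockMass (μ l.succ) mode j) :=
    le_min (blockMass_nonneg (fun x => (expFamily_pos hw hμZ _ x).le) mode j)
      (blockMass_nonneg (fun x => (expFamily_pos hw hμZ _ x).le) mode j)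
  exact (mul_le_mul_of_nonneg_right hmono hB).trans (expFamily_hδ hw hX hμZ hβ mode hK l j)

end ExpFamily

end Summit.Ventures.LatticeQCDFlow.Scaling

end
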